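import Mathlib

/-!
# Tier7/Line3/CoverCountAdditivity — the count of an image over a finite cover is at most the sum over the pieces
(seat t7-L1-p2, gen 7; clause (f) of plan-3's assignment STATUS l. 16065 / l. 16073 (2), crit-2's (iv) of l. 16070;
companion of DoubleCosetCover — a second small file because the first is at its size)

LINE 3 (t7-plan-3), version (ii). SplitFactorConstants p711068 (L1-p3) bounds the split-place count
`b w γ ≤ Σ_j (1 + e₁ + |m_j − n_j|)(1 + e₂ + |m_j − n_j|)` by summing, over the finitely many double cosets met by the
support, the box count of the value pairs of each coset (`ncard_slackBox_le`, `valuePair_mem_slackBox`). The ONE step of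
that chain still in words is the count-side link: for a map `φ : G → β` (the value-pair map `(t, s) ↦ (v s₁, v s₂)`, in
words) and a finite cover `U ⊆ ⋃ t ∈ T, D t` (the double-coset cover of DoubleCosetCover.exists_finset_doubleCoset_cover),
`(φ '' U).ncard ≤ ∑ t ∈ T, (φ '' D t).ncard` — PROVIDED every `φ '' D t` is finite. This module proves exactly that,
Mathlib only:
* `ncard_biUnion_le`: `(⋃ t ∈ T, A t).ncard ≤ ∑ t ∈ T, (A t).ncard` for any finite index set `T` and any sets `A t`
  (induction on `T` with `Set.ncard_union_le`; no finiteness needed — `Set.ncard` of an infinite set is `0`). CRIT-1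
  (vi), l. 16082: when some piece `A t` is infinite this lemma is a statement about `Set.ncard`'s JUNK VALUE only (the
  union is infinite, its `ncard` is `0`, the inequality is empty of content); it carries a count exactly when every piece
  is finite, and EVERY consumer goes through `hfin` in the theorem below;
* `ncard_image_le_sum_of_cover`: `(φ '' U).ncard ≤ ∑ t ∈ T, (φ '' D t).ncard` from `U ⊆ ⋃ t ∈ T, D t` and
  `hfin : ∀ t ∈ T, (φ '' D t).Finite` (the image of `U` lies in the finite union of the images of the pieces, so
  `Set.ncard_le_ncard` applies, then `ncard_biUnion_le`).
JUNK-VALUE GUARD (crit-2 l. 16070 (iv)): WITHOUT `hfin` the inequality is FALSE in general — `Set.ncard` of an infinite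
set is `0`, so an infinite piece contributes `0` on the right while `φ '' U` may be a non-empty finite set; `hfin` is
REQUIRED and is what SplitFactorConstants' `valuePair_mem_slackBox` supplies per coset (the value pairs of one coset lie
in a finite box). With this row the chain «`b w γ ≤ Σ_j (1 + e₁ + |m_j − n_j|)(1 + e₂ + |m_j − n_j|) ≤ Cw w (1 + e₁)(1 + e₂)`»
is three theorems of the model — this link + `ncard_slackBox_le` per coset + the trivial product bound — and what stays in
words shrinks to: `b w γ` IS `(φ '' U_γ).ncard` for the real `U_γ = {(t, s) | t⁻¹ γ s ∈ supp f_w}`, the Cartan index of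
each coset, and the place datum (a′). `[M]`-level; NOT distance to (P); residual (a′)/(b′) unchanged in kind; LEMMAS
CLOSING THE STEP 0. Nothing here is about (N), (P), the real `X`, or HC_CM; §8(d): NO. Blind lane: Mathlib + the
HodgeRepro2 prefix; no sorry; axioms ⊆ {propext, Classical.choice, Quot.sound}.
-/

namespace Summit.Ventures.HodgeRepro2.Tier7.Line3.CoverCountAdditivity

open Set

variable {ι β : Type*}

/-- **the count of a finite union is at most the sum of the counts** (no finiteness hypothesis: `Set.ncard` of an
infinite set is `0`, and `Set.ncard_union_le` holds unconditionally). -/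
theorem ncard_biUnion_le [DecidableEq ι] (T : Finset ι) (A : ι → Set β) :
    (⋃ t ∈ T, A t).ncard ≤ ∑ t ∈ T, (A t).ncard := by
  induction T using Finset.induction_on with
  | empty => simp
  | insert a T ha ih =>
    rw [Finset.set_biUnion_insert, Finset.sum_insert ha]
    exact (Set.ncard_union_le _ _).trans (Nat.add_le_add_left ih _)

variable {G : Type*}

/-- **the count-side link**: the image of a set covered by finitely many pieces has at most as many elements as the sum
of the (finite) image counts of the pieces — `hfin` is REQUIRED (junk-value guard: an infinite piece counts `0`). -/
theorem ncard_image_le_sum_of_cover [DecidableEq G] (φ : G → β) {U : Set G} (T : Finset G) (D : G → Set G)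
    (hcov : U ⊆ ⋃ t ∈ T, D t) (hfin : ∀ t ∈ T, (φ '' D t).Finite) :
    (φ '' U).ncard ≤ ∑ t ∈ T, (φ '' D t).ncard := by
  have hsub : φ '' U ⊆ ⋃ t ∈ T, φ '' D t := by
    refine (Set.image_mono hcov).trans ?_
    rw [Set.image_iUnion₂]
  have hfinU : (⋃ t ∈ T, φ '' D t).Finite := T.finite_toSet.biUnion fun t ht => hfin t ht
  exact (Set.ncard_le_ncard hsub hfinU).trans (ncard_biUnion_le T fun t => φ '' D t)

end Summit.Ventures.HodgeRepro2.Tier7.Line3.CoverCountAdditivity
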